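import Literature.Computability.Cryptography.UOWHF
import Literature.Computability.Cryptography.SignaturesRestrictedOneTime
import Literature.Computability.Cryptography.SchemesProofs
import HarnessLib

/-!
# One-time hash-and-sign: Goldreich 2004, Construction 6.4.30 (the scheme, correctness, efficiency)

Topic `Literature/Computability/Cryptography`; third brick of the printed proof of Goldreich's
Theorem 6.4.1 (the tree's named fact `secureSignaturesExist_of_OWFExist`): the revisited hash-and-sign
paradigm that turns an `ℓ`-restricted one-time signature scheme (`SignaturesRestrictedOneTime.lean`;
Lamport's Construction 6.4.4 from any one-way function, `LamportOTSSecurity.lean`) and a collection of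
universal one-way hash functions (`UOWHF.lean`) into a ONE-TIME signature scheme for documents of
arbitrary length. This file defines the scheme and proves the unconditional parts:

* `HashSign.scheme H S` — **Construction 6.4.30**: `G'` runs `G` (both keys tagged with `1ⁿ` so that
  `S'` can run `I(1ⁿ)`); `S'(⟨1ⁿ, s⟩, α)` draws `β₁ ← I(1ⁿ)` and outputs `⟨β₁, S_s(⟨β₁, h_{β₁}(α)⟩)⟩`;
  `V'(⟨1ⁿ, v⟩, α, ⟨β₁, β₂⟩) = [|β₁| = n] ∧ V_v(⟨β₁, h_{β₁}(α)⟩, β₂)`;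
* `HashSign.isCorrect` — full correctness from `ℓ`-restricted correctness of `S`, for
  `ℓ(n) = 2n + 2 + ℓ'(n)` (the length of the pair code `⟨β₁, h_{β₁}(α)⟩` when `|β₁| = n` and `h` has
  range specifier `ℓ'`);
* `HashSign.isEfficient` — the three algorithms are PPT when `S` is efficient and `H` is efficient
  (and the signing coin budget is polynomially bounded).

Deviations from the text (harmless, documented): keys carry `1ⁿ`; the pair `(β₁, h_{β₁}(α))` is the
pair CODE `boolPair` (hence `ℓ(n) = 2n + 2 + ℓ'(n)` instead of `n + ℓ'(n)`); `V'` additionally checks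
`|β₁| = n` (so that the signed value has the restricted length); we assume the index sampler outputs
indices of length exactly `n` on `1ⁿ` (footnote 34's stringent form of admissibility).

The security statement (Prop. 6.4.31, furthermore-part: `H.IsUOWHF ℓ'` and
`S.IsRestrictedOneTimeSecure ℓ` give `(HashSign.scheme H S).IsOneTimeSecure`) is the subject of the
companion `HashAndSignOTSSecurity.lean`.

## References

* O. Goldreich, *Foundations of Cryptography II: Basic Applications*, CUP 2004, §6.4.3.3,
  Construction 6.4.30 and Prop. 6.4.31 (PDF pp. 268–272 of the held copy); Def. 6.4.18; Def. 6.4.3.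
* M. Naor, M. Yung, *Universal one-way hash functions and their cryptographic applications*, STOC 1989.
-/

namespace Literature.Computability.Cryptography

open Filter Asymptotics _root_.Computability Complexity Finset Polynomial
open Complexity.Brick

namespace HashSign

variable (H : HashCollection) (S : SignatureScheme)

/-! ### Construction 6.4.30 -/

/-- Key generation `G'`: run `G(1ⁿ)` and tag both keys with `1ⁿ`. [Goldreich 2004, Construction 6.4.30
("with `G'` identical to `G`")] [cite: Goldreich2004, Construction 6.4.30] -/
def keyGen' : RandAlg ℕ (List Bool × List Bool) :=
  ⟨fun n r => (boolPair (ones n) (S.keyGen.run n r).1, boolPair (ones n) (S.keyGen.run n r).2), S.keyGen.coinLen⟩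

/-- The hash index drawn by the signer: `β₁ = I(1ⁿ; ρ ↾ p_I(n))` (`n = |fstF sk'|`; `p_I` is the index
sampler's coin polynomial). [Goldreich 2004, Construction 6.4.30 (signing, step 1)]
[cite: Goldreich2004, Construction 6.4.30] -/
def beta1 (pI : Polynomial ℕ) (sk' ρ : List Bool) : List Bool :=
  H.index.run (fstF sk').length (ρ.take (pI.eval (fstF sk').length))

/-- The value signed with the restricted scheme: `⟨β₁, h_{β₁}(α)⟩`. [Goldreich 2004, Construction 6.4.30
(signing, step 2)] [cite: Goldreich2004, Construction 6.4.30] -/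
def hashedMsg (β₁ α : List Bool) : List Bool := boolPair β₁ (H.hash β₁ α)

/-- The restricted-scheme signature `β₂ = S_s(⟨β₁, h_{β₁}(α)⟩; ρ')`, with `ρ'` the coins after those of
`I`, cut to the signer's coin polynomial `p_S`. [Goldreich 2004, Construction 6.4.30 (signing, step 2)]
[cite: Goldreich2004, Construction 6.4.30] -/
def beta2 (pI pS : Polynomial ℕ) (sk' α ρ : List Bool) : List Bool :=
  S.sign.run (sndF sk', hashedMsg H (beta1 H pI sk' ρ) α)
    ((ρ.drop (pI.eval (fstF sk').length)).take
      (pS.eval (pairCode (sndF sk', hashedMsg H (beta1 H pI sk' ρ) α)).length))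

/-- Signing `S'(sk', α; ρ) = ⟨β₁, β₂⟩`; the coin budget `CL` (any sufficient one). [Goldreich 2004,
Construction 6.4.30 (signing)] [cite: Goldreich2004, Construction 6.4.30] -/
def sign' (pI pS : Polynomial ℕ) (CL : ℕ → ℕ) : RandAlg (List Bool × List Bool) (List Bool) :=
  ⟨fun p ρ => boolPair (beta1 H pI p.1 ρ) (beta2 H S pI pS p.1 p.2 ρ), CL⟩

/-- Verification `V'(pk', α, σ) = [|β₁| = n] ∧ V_v(⟨β₁, h_{β₁}(α)⟩, β₂)` with `β₁ = fstF σ`,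
`β₂ = sndF σ`, `n = |fstF pk'|`, `v = sndF pk'`. [Goldreich 2004, Construction 6.4.30 (verification)]
[cite: Goldreich2004, Construction 6.4.30] -/
def verify' (pk' α σ : List Bool) : Bool :=
  decide ((fstF σ).length = (fstF pk').length) && S.verify (sndF pk') (hashedMsg H (fstF σ) α) (sndF σ)

/-- **Construction 6.4.30** (one-time hash-and-sign) as a `SignatureScheme`: `p_I`, `p_S` are the coin
polynomials of the index sampler and of the signer of `S` (the construction must split its coin string
between them, so their budgets must be explicit), `CL` the total signing coin budget.
[Goldreich 2004, Construction 6.4.30] [cite: Goldreich2004, Construction 6.4.30] -/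
def scheme (pI pS : Polynomial ℕ) (CL : ℕ → ℕ) : SignatureScheme where
  keyGen := keyGen' S
  sign := sign' H S pI pS CL
  verify := verify' H S

/-! ### Correctness -/

/-- The length of the signed value when `|β₁| = n` and `h` has range specifier `ℓ'`. [folklore] -/
theorem length_hashedMsg {ℓ' : ℕ → ℕ} (hR : H.HasRange ℓ') {β₁ : List Bool} {n : ℕ} (hβ : β₁.length = n) (α : List Bool) :
    (hashedMsg H β₁ α).length = 2 * n + 2 + ℓ' n := by
  rw [hashedMsg, length_boolPair, hR, hβ]

/-- The keys of `G'(1ⁿ)`: tagged honest keys of `G(1ⁿ)`. [folklore] -/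
theorem exists_of_mem_support_keyPMF {pI pS : Polynomial ℕ} {CL : ℕ → ℕ} {n : ℕ} {ks : List Bool × List Bool}
    (h : ks ∈ ((scheme H S pI pS CL).keyPMF n).support) :
    ∃ ks₀ ∈ (S.keyPMF n).support, ks = (boolPair (ones n) ks₀.1, boolPair (ones n) ks₀.2) := by
  rw [SignatureScheme.keyPMF, RandAlg.outputPMF, PMF.support_map] at h
  obtain ⟨v, -, rfl⟩ := h
  refine ⟨S.keyGen.run n v.toList, ?_, rfl⟩
  rw [SignatureScheme.keyPMF, RandAlg.outputPMF, PMF.support_map]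
  exact ⟨v, by rw [PMF.support_uniformOfFintype]; exact Set.mem_univ _, rfl⟩

/-- A signature of `S'` is `⟨β₁, β₂⟩` with `β₂` an honest `S`-signature of the signed value, provided the
coin budget covers the signer's needs and `p_S` is the signer's coin budget. [folklore] -/
theorem exists_of_mem_support_sigPMF {pI pS : Polynomial ℕ} (hpS : ∀ k, S.sign.coinLen k = pS.eval k) {CL : ℕ → ℕ}
    {sk α σ : List Bool} (n : ℕ)
    (hCLall : ∀ ρ : List Bool, pI.eval n +
      pS.eval (pairCode (sk, hashedMsg H (beta1 H pI (boolPair (ones n) sk) ρ) α)).length ≤ CL (pairCode (boolPair (ones n) sk, α)).length)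
    (h : σ ∈ ((scheme H S pI pS CL).sigPMF (boolPair (ones n) sk) α).support) :
    ∃ ρ : List Bool, ρ.length = CL (pairCode (boolPair (ones n) sk, α)).length ∧
      σ = boolPair (beta1 H pI (boolPair (ones n) sk) ρ) (beta2 H S pI pS (boolPair (ones n) sk) α ρ) ∧
      beta2 H S pI pS (boolPair (ones n) sk) α ρ ∈ (S.sigPMF sk (hashedMsg H (beta1 H pI (boolPair (ones n) sk) ρ) α)).support := by
  rw [SignatureScheme.sigPMF, RandAlg.outputPMF, PMF.support_map] at h
  obtain ⟨v, -, rfl⟩ := h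
  refine ⟨v.toList, v.toList_length, rfl, ?_⟩
  have hlen := hCLall v.toList
  have hv : v.toList.length = CL (pairCode (boolPair (ones n) sk, α)).length := v.toList_length
  simp only [beta2, beta1, fstF_boolPair, sndF_boolPair, List.length_replicate] at hlen ⊢
  apply SigOWF.FParams.mem_support_sigPMF
  rw [List.length_take, List.length_drop, hv, hpS]
  omega

/-- The index sampled by the signer has the law `I(1ⁿ)` only if it is fed exactly `c_I(n)` coins; under
`c_I = p_I` it lies in the range of `I(1ⁿ)`. [folklore] -/
theorem beta1_mem_support {pI : Polynomial ℕ} (hpI : ∀ n, H.index.coinLen n = pI.eval n) {n : ℕ} (sk ρ : List Bool)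
    (hρ : pI.eval n ≤ ρ.length) : beta1 H pI (boolPair (ones n) sk) ρ ∈ (H.indexPMF n).support := by
  rw [HashCollection.indexPMF, RandAlg.outputPMF, PMF.support_map]
  have hl : (ρ.take (pI.eval n)).length = H.index.coinLen (unaryEncodeNat n).length := by
    rw [List.length_take, Complexity.unaryEncodeNat_eq_replicate, List.length_replicate, hpI]; omega
  refine ⟨⟨ρ.take (pI.eval n), hl⟩, by rw [PMF.support_uniformOfFintype]; exact Set.mem_univ _, ?_⟩
  simp [beta1]

/-- **Correctness of Construction 6.4.30**: if `S` is correct on documents of length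
`ℓ(n) = 2n + 2 + ℓ'(n)`, `h` has range specifier `ℓ'`, indices in the range of `I(1ⁿ)` have length `n`,
`p_I`, `p_S` are the coin budgets of `I` and of `S`'s signer, and the total budget suffices, then `S'` is
(fully) correct. [Goldreich 2004, Construction 6.4.30 with Def. 6.2.1] [cite: Goldreich2004, Construction 6.4.30] -/
theorem isCorrect {ℓ ℓ' : ℕ → ℕ} (hℓ : ∀ n, ℓ n = 2 * n + 2 + ℓ' n) (hR : H.HasRange ℓ')
    {pI pS : Polynomial ℕ} (hpI : ∀ n, H.index.coinLen n = pI.eval n) (hpS : ∀ k, S.sign.coinLen k = pS.eval k)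
    (hlen : ∀ n, ∀ s ∈ (H.indexPMF n).support, s.length = n)
    (hcorr : S.IsRestrictedCorrect ℓ) {CL : ℕ → ℕ}
    (hCL : ∀ (n : ℕ) (sk α ρ : List Bool), pI.eval n +
      pS.eval (pairCode (sk, hashedMsg H (beta1 H pI (boolPair (ones n) sk) ρ) α)).length ≤ CL (pairCode (boolPair (ones n) sk, α)).length) :
    (scheme H S pI pS CL).IsCorrect := by
  intro n ks hks α σ hσ
  obtain ⟨ks₀, hks₀, rfl⟩ := exists_of_mem_support_keyPMF H S hks
  obtain ⟨ρ, hρlen, rfl, hβ₂⟩ := exists_of_mem_support_sigPMF H S hpS n (hCL n ks₀.2 α) hσ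
  have hρ : pI.eval n ≤ ρ.length := by
    have := hCL n ks₀.2 α ρ
    rw [hρlen]; omega
  have hβ₁ : (beta1 H pI (boolPair (ones n) ks₀.2) ρ).length = n :=
    hlen n _ (beta1_mem_support H hpI ks₀.2 ρ hρ)
  have hm : (hashedMsg H (beta1 H pI (boolPair (ones n) ks₀.2) ρ) α).length = ℓ n := by
    rw [hℓ, length_hashedMsg H hR hβ₁]
  have hv := hcorr n ks₀ hks₀ _ hm _ hβ₂
  show verify' H S (boolPair (ones n) ks₀.1) α _ = true
  simp only [verify', fstF_boolPair, sndF_boolPair, List.length_replicate, hβ₁, decide_true, Bool.true_and]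
  exact hv

/-! ### Efficiency: Construction 6.4.30 is a triple of polynomial-time algorithms -/

section Programs

open Complexity.Plumb Complexity.OracleCompose

variable {H S}

/-- The index sampler as a string function: `⟨u, r⟩ ↦ I(1^{|u|}; r)`. [folklore] -/
def iFn (H : HashCollection) (z : List Bool) : List Bool := H.index.run (fstF z).length (sndF z)

/-- `iFn ∈ FP` for an efficient sampler. [Arora–Barak 2009, §1.3] [folklore] -/
theorem iFn_mem_FP (hI : H.index.IsPolyTime unaryEncodeNat (id : List Bool → List Bool)) : iFn H ∈ FP := by
  have hnorm : fanoutFn (onesFn ∘ fstF) sndF ∈ FP :=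
    fanoutFn_mem_FP (comp_mem_FP onesFn_mem_FP fstF_mem_FP) sndF_mem_FP
  have hdec : PolyTimeComputable (id : List Bool → List Bool) (fun p : ℕ × List Bool => boolPair (unaryEncodeNat p.1) p.2)
      (fun z : List Bool => ((fstF z).length, sndF z)) := by
    obtain ⟨p, M, hM⟩ := hnorm
    refine ⟨p, M, fun z => ?_⟩
    have h := hM z
    simp only [id, fanoutFn_apply, Function.comp_apply, onesFn] at h ⊢
    exact h
  obtain ⟨p, M, hM⟩ := PolyTimeComputable.comp_holds hI.1 hdec
  exact ⟨p, M, fun z => hM z⟩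

/-- The hash evaluation as a string function: `⟨s, x⟩ ↦ h_s(x)`. [folklore] -/
def hFn (H : HashCollection) (z : List Bool) : List Bool := H.hash (fstF z) (sndF z)

/-- `hFn ∈ FP` for an efficiently evaluated collection. [Arora–Barak 2009, §1.3] [folklore] -/
theorem hFn_mem_FP (hh : PolyTimeComputable pairCode (id : List Bool → List Bool) (fun p : List Bool × List Bool => H.hash p.1 p.2)) :
    hFn H ∈ FP := by
  have hdec : PolyTimeComputable (id : List Bool → List Bool) pairCode (fun z : List Bool => (fstF z, sndF z)) := by
    obtain ⟨p, M, hM⟩ := fanoutFn_mem_FP fstF_mem_FP sndF_mem_FP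
    refine ⟨p, M, fun z => ?_⟩
    have h := hM z
    simp only [id, fanoutFn_apply] at h ⊢
    exact h
  obtain ⟨p, M, hM⟩ := PolyTimeComputable.comp_holds hh hdec
  exact ⟨p, M, fun z => hM z⟩

/-- The `SigOWF` wrappers of `S`'s algorithms, with an irrelevant coin bound. [folklore] -/
noncomputable def ctx (S : SignatureScheme) : SigOWF.Ctx := ⟨S, 0⟩

/-! #### Key generation -/

/-- `G'` as a string function on `z = ⟨1ⁿ, r⟩`. [Goldreich 2004, Construction 6.4.30] [cite: Goldreich2004, Construction 6.4.30] -/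
noncomputable def kgFn' (S : SignatureScheme) : List Bool → List Bool :=
  fanoutFn (fanoutFn (onesFn ∘ fstF) (fstF ∘ SigOWF.kgFn (ctx S))) (fanoutFn (onesFn ∘ fstF) (sndF ∘ SigOWF.kgFn (ctx S)))

/-- `kgFn' ∈ FP` for an efficient `G`. [folklore] -/
theorem kgFn'_mem_FP (hK : S.keyGen.IsPolyTime unaryEncodeNat pairCode) : kgFn' S ∈ FP :=
  fanoutFn_mem_FP (fanoutFn_mem_FP (comp_mem_FP onesFn_mem_FP fstF_mem_FP) (comp_mem_FP fstF_mem_FP (SigOWF.kgFn_mem_FP hK.1)))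
    (fanoutFn_mem_FP (comp_mem_FP onesFn_mem_FP fstF_mem_FP) (comp_mem_FP sndF_mem_FP (SigOWF.kgFn_mem_FP hK.1)))

/-- Semantics of `kgFn'`. [folklore] -/
theorem kgFn'_apply (n : ℕ) (r : List Bool) :
    kgFn' S (boolPair (unaryEncodeNat n) r) = pairCode ((keyGen' S).run n r) := by
  simp only [kgFn', fanoutFn_apply, Function.comp_apply, fstF_boolPair, SigOWF.kgFn_boolPair, onesFn,
    Complexity.unaryEncodeNat_eq_replicate, List.length_replicate]
  show boolPair (boolPair _ (fstF (boolPair _ _))) (boolPair _ (sndF (boolPair _ _))) = boolPair _ _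
  rw [fstF_boolPair, sndF_boolPair]
  rfl

/-- `G'` is PPT when `G` is. [Goldreich 2004, Construction 6.4.30] [cite: Goldreich2004, Construction 6.4.30] -/
theorem keyGen'_isPolyTime (hK : S.keyGen.IsPolyTime unaryEncodeNat pairCode) : (keyGen' S).IsPolyTime unaryEncodeNat pairCode := by
  refine ⟨?_, hK.2⟩
  refine PolyTimeComputable.of_encode (kgFn'_mem_FP hK) (fun p : ℕ × List Bool => boolPair (unaryEncodeNat p.1) p.2)
    (fun _ => rfl) fun p => ?_
  exact kgFn'_apply p.1 p.2

/-! #### Signing -/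

variable (H S) (pI pS : Polynomial ℕ)

/-- `1ⁿ` read off the signing input `⟨⟨⟨1ⁿ, sk⟩, α⟩, ρ⟩`. [folklore] -/
noncomputable def snU : List Bool → List Bool := fstF ∘ fstF ∘ fstF

/-- The index coins `ρ ↾ p_I(n)`. [folklore] -/
noncomputable def srI : List Bool → List Bool := takeFn ∘ fanoutFn (polyFn pI ∘ snU) sndF

/-- `β₁` as a string function. [folklore] -/
noncomputable def sBeta1 : List Bool → List Bool := iFn H ∘ fanoutFn (snU) (srI pI)

/-- `β₁` on a signing input (every `sk'`). [folklore] -/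
theorem sBeta1_apply (sk' α ρ : List Bool) : sBeta1 H pI (boolPair (boolPair sk' α) ρ) = beta1 H pI sk' ρ := by
  simp [sBeta1, srI, snU, iFn, beta1]

/-- `sBeta1 ∈ FP`. [folklore] -/
theorem sBeta1_mem_FP (hI : H.index.IsPolyTime unaryEncodeNat (id : List Bool → List Bool)) : sBeta1 H pI ∈ FP :=
  comp_mem_FP (iFn_mem_FP hI) (fanoutFn_mem_FP (comp_mem_FP fstF_mem_FP (comp_mem_FP fstF_mem_FP fstF_mem_FP))
    (comp_mem_FP takeFn_mem_FP (fanoutFn_mem_FP (comp_mem_FP (polyFn_mem_FP pI)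
      (comp_mem_FP fstF_mem_FP (comp_mem_FP fstF_mem_FP fstF_mem_FP))) sndF_mem_FP)))

/-- The signed value `⟨β₁, h_{β₁}(α)⟩` as a string function. [folklore] -/
noncomputable def sMsg : List Bool → List Bool := fanoutFn (sBeta1 H pI) (hFn H ∘ fanoutFn (sBeta1 H pI) (sndF ∘ fstF))

/-- `sMsg` on a signing input. [folklore] -/
theorem sMsg_apply (sk' α ρ : List Bool) : sMsg H pI (boolPair (boolPair sk' α) ρ) = hashedMsg H (beta1 H pI sk' ρ) α := by
  simp only [sMsg, fanoutFn_apply, Function.comp_apply, sBeta1_apply, fstF_boolPair, sndF_boolPair, hFn, hashedMsg]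

/-- `sMsg ∈ FP`. [folklore] -/
theorem sMsg_mem_FP (hI : H.index.IsPolyTime unaryEncodeNat (id : List Bool → List Bool))
    (hh : PolyTimeComputable pairCode (id : List Bool → List Bool) (fun p : List Bool × List Bool => H.hash p.1 p.2)) : sMsg H pI ∈ FP :=
  fanoutFn_mem_FP (sBeta1_mem_FP H pI hI) (comp_mem_FP (hFn_mem_FP hh) (fanoutFn_mem_FP (sBeta1_mem_FP H pI hI) (comp_mem_FP sndF_mem_FP fstF_mem_FP)))

/-- The inner signing record `⟨⟨sk, m⟩, coins⟩` for `S`: `sk = sndF sk'`, coins `(ρ ⇂ p_I(n)) ↾ p_S(|⟨sk, m⟩|)`. [folklore] -/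
noncomputable def sRec : List Bool → List Bool :=
  fanoutFn (fanoutFn (sndF ∘ fstF ∘ fstF) (sMsg H pI))
    (takeFn ∘ fanoutFn (polyFn pS ∘ fanoutFn (sndF ∘ fstF ∘ fstF) (sMsg H pI)) (dropFn ∘ fanoutFn (polyFn pI ∘ snU) sndF))

/-- `sRec` on a signing input. [folklore] -/
theorem sRec_apply (sk' α ρ : List Bool) : sRec H pI pS (boolPair (boolPair sk' α) ρ) =
    boolPair (boolPair (sndF sk') (hashedMsg H (beta1 H pI sk' ρ) α))
      ((ρ.drop (pI.eval (fstF sk').length)).take (pS.eval (pairCode (sndF sk', hashedMsg H (beta1 H pI sk' ρ) α)).length)) := by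
  simp only [sRec, fanoutFn_apply, Function.comp_apply, fstF_boolPair, sndF_boolPair, sMsg_apply, polyFn_apply, takeFn_boolPair,
    dropFn_boolPair, List.length_replicate, snU]
  rfl

/-- `sRec ∈ FP`. [folklore] -/
theorem sRec_mem_FP (hI : H.index.IsPolyTime unaryEncodeNat (id : List Bool → List Bool))
    (hh : PolyTimeComputable pairCode (id : List Bool → List Bool) (fun p : List Bool × List Bool => H.hash p.1 p.2)) : sRec H pI pS ∈ FP :=
  fanoutFn_mem_FP (fanoutFn_mem_FP (comp_mem_FP sndF_mem_FP (comp_mem_FP fstF_mem_FP fstF_mem_FP)) (sMsg_mem_FP H pI hI hh))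
    (comp_mem_FP takeFn_mem_FP (fanoutFn_mem_FP (comp_mem_FP (polyFn_mem_FP pS)
      (fanoutFn_mem_FP (comp_mem_FP sndF_mem_FP (comp_mem_FP fstF_mem_FP fstF_mem_FP)) (sMsg_mem_FP H pI hI hh)))
      (comp_mem_FP dropFn_mem_FP (fanoutFn_mem_FP (comp_mem_FP (polyFn_mem_FP pI)
        (comp_mem_FP fstF_mem_FP (comp_mem_FP fstF_mem_FP fstF_mem_FP))) sndF_mem_FP))))

/-- `S'` as a string function: `⟨β₁, S(⟨sk, m⟩; coins)⟩`. [Goldreich 2004, Construction 6.4.30] [cite: Goldreich2004, Construction 6.4.30] -/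
noncomputable def signFn' : List Bool → List Bool := fanoutFn (sBeta1 H pI) (SigOWF.signFn (ctx S) ∘ sRec H pI pS)

/-- `signFn'` on a signing input (every `sk'`). [folklore] -/
theorem signFn'_apply (sk' α ρ : List Bool) :
    signFn' H S pI pS (boolPair (boolPair sk' α) ρ) = boolPair (beta1 H pI sk' ρ) (beta2 H S pI pS sk' α ρ) := by
  simp only [signFn', fanoutFn_apply, Function.comp_apply, sBeta1_apply, sRec_apply, SigOWF.signFn_boolPair, beta2]
  rfl

/-- `signFn' ∈ FP`. [folklore] -/
theorem signFn'_mem_FP (hI : H.index.IsPolyTime unaryEncodeNat (id : List Bool → List Bool))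
    (hh : PolyTimeComputable pairCode (id : List Bool → List Bool) (fun p : List Bool × List Bool => H.hash p.1 p.2))
    (hSg : S.sign.IsPolyTime pairCode (id : List Bool → List Bool)) : signFn' H S pI pS ∈ FP :=
  fanoutFn_mem_FP (sBeta1_mem_FP H pI hI) (comp_mem_FP (SigOWF.signFn_mem_FP (P := ctx S) hSg.1) (sRec_mem_FP H pI pS hI hh))

/-- `S'` is PPT (for efficient `I`, `h`, `S` and a polynomial coin budget). [Goldreich 2004, Construction 6.4.30]
[cite: Goldreich2004, Construction 6.4.30] -/
theorem sign'_isPolyTime (hI : H.index.IsPolyTime unaryEncodeNat (id : List Bool → List Bool))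
    (hh : PolyTimeComputable pairCode (id : List Bool → List Bool) (fun p : List Bool × List Bool => H.hash p.1 p.2))
    (hSg : S.sign.IsPolyTime pairCode (id : List Bool → List Bool)) {CL : ℕ → ℕ} (CP : Polynomial ℕ) (hCL : ∀ N, CL N ≤ CP.eval N) :
    (sign' H S pI pS CL).IsPolyTime pairCode (id : List Bool → List Bool) := by
  refine ⟨?_, CP, hCL⟩
  refine PolyTimeComputable.of_encode (signFn'_mem_FP H S pI pS hI hh hSg)
    (fun p : (List Bool × List Bool) × List Bool => boolPair (pairCode p.1) p.2) (fun _ => rfl) fun p => ?_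
  exact signFn'_apply H S pI pS p.1.1 p.1.2 p.2

/-! #### Verification -/

/-- `V'` as a string function on `⟨pk', ⟨α, σ⟩⟩`. [Goldreich 2004, Construction 6.4.30] [cite: Goldreich2004, Construction 6.4.30] -/
noncomputable def verFn' : List Bool → List Bool :=
  andFn (eqPairFn ∘ fanoutFn (onesFn ∘ fstF ∘ sndPow 1) (onesFn ∘ fstF ∘ fstF))
    (SigOWF.verFn (ctx S) ∘ fanoutFn (sndF ∘ fstF)
      (fanoutFn (fanoutFn (fstF ∘ sndPow 1) (hFn H ∘ fanoutFn (fstF ∘ sndPow 1) (nthF 1))) (sndF ∘ sndPow 1)))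

/-- `verFn'` on a verification input (every `pk'`). [folklore] -/
theorem verFn'_apply (pk' α σ : List Bool) : verFn' H S (boolPair pk' (boolPair α σ)) = [verify' H S pk' α σ] := by
  have h1 : (eqPairFn ∘ fanoutFn (onesFn ∘ fstF ∘ sndPow 1) (onesFn ∘ fstF ∘ fstF)) (boolPair pk' (boolPair α σ)) =
      [decide ((fstF σ).length = (fstF pk').length)] := by
    simp only [Function.comp_apply, fanoutFn_apply, sndPow_succ_boolPair, sndPow_zero, sndF_boolPair, fstF_boolPair, eqPairFn_boolPair,
      onesFn, Complexity.unaryEncodeNat_eq_replicate]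
    simp
  have h2 : (SigOWF.verFn (ctx S) ∘ fanoutFn (sndF ∘ fstF)
      (fanoutFn (fanoutFn (fstF ∘ sndPow 1) (hFn H ∘ fanoutFn (fstF ∘ sndPow 1) (nthF 1))) (sndF ∘ sndPow 1))) (boolPair pk' (boolPair α σ)) =
      [S.verify (sndF pk') (hashedMsg H (fstF σ) α) (sndF σ)] := by
    simp only [Function.comp_apply, fanoutFn_apply, sndPow_succ_boolPair, sndPow_zero, sndF_boolPair, fstF_boolPair, nthF_succ_boolPair,
      nthF_zero_boolPair, SigOWF.verFn_boolPair, hFn, hashedMsg]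
    rfl
  rw [verFn', andFn_apply h1 h2, verify']

/-- `verFn' ∈ FP`. [folklore] -/
theorem verFn'_mem_FP (hh : PolyTimeComputable pairCode (id : List Bool → List Bool) (fun p : List Bool × List Bool => H.hash p.1 p.2))
    (hV : PolyTimeComputable SignatureScheme.verifyCode encodeBool (fun p : List Bool × List Bool × List Bool => S.verify p.1 p.2.1 p.2.2)) :
    verFn' H S ∈ FP :=
  andFn_mem_FP (comp_mem_FP eqPairFn_mem_FP (fanoutFn_mem_FP (comp_mem_FP onesFn_mem_FP (comp_mem_FP fstF_mem_FP (sndPow_mem_FP 1)))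
      (comp_mem_FP onesFn_mem_FP (comp_mem_FP fstF_mem_FP fstF_mem_FP))))
    (comp_mem_FP (SigOWF.verFn_mem_FP (P := ctx S) hV) (fanoutFn_mem_FP (comp_mem_FP sndF_mem_FP fstF_mem_FP)
      (fanoutFn_mem_FP (fanoutFn_mem_FP (comp_mem_FP fstF_mem_FP (sndPow_mem_FP 1))
        (comp_mem_FP (hFn_mem_FP hh) (fanoutFn_mem_FP (comp_mem_FP fstF_mem_FP (sndPow_mem_FP 1)) (nthF_mem_FP 1))))
        (comp_mem_FP sndF_mem_FP (sndPow_mem_FP 1)))))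

/-- `V'` is polynomial-time. [Goldreich 2004, Construction 6.4.30] [cite: Goldreich2004, Construction 6.4.30] -/
theorem verify'_polyTime (hh : PolyTimeComputable pairCode (id : List Bool → List Bool) (fun p : List Bool × List Bool => H.hash p.1 p.2))
    (hV : PolyTimeComputable SignatureScheme.verifyCode encodeBool (fun p : List Bool × List Bool × List Bool => S.verify p.1 p.2.1 p.2.2)) :
    PolyTimeComputable SignatureScheme.verifyCode encodeBool (fun p : List Bool × List Bool × List Bool => verify' H S p.1 p.2.1 p.2.2) := by
  refine PolyTimeComputable.of_encode (verFn'_mem_FP H S hh hV) SignatureScheme.verifyCode (fun _ => rfl) fun p => ?_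
  exact verFn'_apply H S p.1 p.2.1 p.2.2

/-- **Construction 6.4.30 is efficient** whenever `S` and `H` are and the signing coin budget is polynomially
bounded. [Goldreich 2004, Construction 6.4.30] [cite: Goldreich2004, Construction 6.4.30] -/
theorem isEfficient (hS : S.IsEfficient) (hH : H.IsEfficient) {CL : ℕ → ℕ} (CP : Polynomial ℕ) (hCL : ∀ N, CL N ≤ CP.eval N) :
    (scheme H S pI pS CL).IsEfficient :=
  ⟨keyGen'_isPolyTime hS.1, sign'_isPolyTime H S pI pS hH.1 hH.2 hS.2.1 CP hCL, verify'_polyTime H S hH.2 hS.2.2⟩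

end Programs

end HashSign

end Literature.Computability.Cryptography
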